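import Summits.ResolutionOfSingularities.ResolutionOfSingularities.Theorems.EquisingularLiftEquisingularLiftNatNDFanSeparation
import Summits.ResolutionOfSingularities.ResolutionOfSingularities.Theorems.EquisingularLiftEquisingularLiftNatFanGameWinnable
import HarnessLib

/-!
# [OURS · L1 W4.5(b) · EL♮(3) · D-0157 DOOR 1, WIDTH row iso-w4] FAN-GAME WINNABILITY — brick 2a: the FAN toolkit
# (separation along plays from the orthant, the «ray in another cone» exclusion, COVERAGE, coefficient bookkeeping under a star)

res-L1-w45b-iso-w4 g0 (prover, width seat; desk WIDTH TABLE D1/D1′; referee crit-2). `--supports stmt-ResolutionOfSingularities-20148 --as helper`.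
Def-light (three bookkeeping defs `FanGame.Separated`, `FanGame.Rep`, `FanGame.Covers`), sorry-free, fact-free. OURS; counted 0; AI kernel work, weaker
than expert review; NOT a statement of any manuscript; nothing of [Hironaka2017] is used; resolution of singularities in characteristic `p` is NOT
proved here or anywhere in this chain.

## Role in the row (blueprint `L/res-L1-w45b-iso-w4/FANGAME-MEMO.md` §6: «NODES FIRST, THEN WALLS»)

The winning schedule for the local fan game on an arbitrary table `V ⊂ ℕ³` needs three facts about positions reachable from `orthantFan n`, all
finitary and proved here for every `n`:
* SEPARATION (`FanGame.separated_of_reach_orthant`): the maximal cones are pairwise separated by integral functionals — the induction from the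
  single orthant cone (vacuously separated) along res-L1-w45b-iso-w3's `ND.separated_star` (p643616) and the tree's smoothness along plays;
* the FAN EXCLUSION (`FanGame.mem_of_smul_rep`): a ray `w` of one cone a positive multiple of which is an `ℕ`-combination of the rays of another
  cone `σ` belongs to `σ` (one line from separation) — this is what forbids a node made into a ray by PHASE 1 from hiding inside another cone;
* COVERAGE (`FanGame.covers_of_reach_orthant`): every lattice point of the closed orthant is an `ℕ`-combination of the rays of some maximal cone, with
  the explicit coefficient bookkeeping `FanGame.rep_star` under a star (new coefficient sum = old sum − (`|τ| − 1`)·(minimal coefficient on `τ`)),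
  which is also PHASE 1's termination count.
-/

set_option linter.dupNamespace false

open Matrix

namespace Summit.ResolutionOfSingularities.ResolutionOfSingularities.Cruxes.EquisingularLiftNat.Sections

namespace FanGame

variable {n : ℕ}

/-! ### Separation along plays from the orthant -/

/-- The maximal cones of a position are PAIRWISE SEPARATED: for `σ₁ ≠ σ₂` some integral functional vanishes on the common rays, is positive on the
rays of `σ₁` not in `σ₂` and negative on the rays of `σ₂` not in `σ₁` (res-L1-w45b-iso-w3's invariant, p643616, named). [OURS · bookkeeping] -/
def Separated (F : Finset (Finset (Ray n))) : Prop :=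
  ∀ σ₁ ∈ F, ∀ σ₂ ∈ F, σ₁ ≠ σ₂ → ∃ u : Ray n, (∀ ρ ∈ σ₁, ρ ∈ σ₂ → u ⬝ᵥ ρ = 0) ∧
    (∀ ρ ∈ σ₁, ρ ∉ σ₂ → 0 < u ⬝ᵥ ρ) ∧ (∀ ρ ∈ σ₂, ρ ∉ σ₁ → u ⬝ᵥ ρ < 0)

/-- The orthant position (one cone) is separated, vacuously. -/
theorem separated_orthant : Separated (orthantFan n) := by
  intro σ₁ hσ₁ σ₂ hσ₂ hne
  rw [orthantFan, Finset.mem_singleton] at hσ₁ hσ₂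
  exact absurd (hσ₁.trans hσ₂.symm) hne

/-- **Separation along `Reach` from smooth separated positions** (induction along iso-w3's `ND.separated_star`). -/
theorem separated_of_reach (V : Finset (Fin n → ℕ)) {F₀ F : Finset (Finset (Ray n))} (h : Reach V F₀ F)
    (hS : ∀ σ ∈ F₀, ND.IsSmoothCone σ) (hSep : Separated F₀) : Separated F := by
  induction h with
  | refl => exact hSep
  | step F₂ τ σ hR hσ hτσ _ _ ih =>
    exact ND.separated_star (ND.isSmoothCone_of_reach V hR hS) ih hσ hτσ

/-- **Every position of the local game is separated.** [OURS · L1 W4.5b · row iso-w4, brick 2a] -/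
theorem separated_of_reach_orthant (V : Finset (Fin n → ℕ)) {F : Finset (Finset (Ray n))} (h : Reach V (orthantFan n) F) :
    Separated F :=
  separated_of_reach V h (fun σ hσ => by
    rw [orthantFan, Finset.mem_singleton] at hσ; rw [hσ]; exact ND.isSmoothCone_orthant) separated_orthant

/-! ### Representations of lattice points by the rays of a cone -/

/-- `Rep σ c x`: the lattice point `x` is the `ℕ`-combination `Σ_{ρ ∈ σ} c ρ • ρ` of the rays of `σ`. [OURS · bookkeeping] -/
def Rep (σ : Finset (Ray n)) (c : Ray n → ℕ) (x : Ray n) : Prop := ∑ ρ ∈ σ, (c ρ : ℤ) • ρ = x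

/-- **THE FAN EXCLUSION.** In a separated position, if a positive multiple of a ray `w` of a cone `σ''` is an `ℕ`-combination of the rays of a cone
`σ`, then `w ∈ σ`.  (The separator of `σ''` from `σ` is positive on `w ∉ σ` and non-positive on every ray of `σ`.) [OURS · L1 W4.5b · brick 2a] -/
theorem mem_of_smul_rep {F : Finset (Finset (Ray n))} (hSep : Separated F) {σ σ'' : Finset (Ray n)} (hσ : σ ∈ F) (hσ'' : σ'' ∈ F)
    {w : Ray n} (hw : w ∈ σ'') {k : ℕ} (hk : 0 < k) {c : Ray n → ℕ} (hx : Rep σ c ((k : ℤ) • w)) : w ∈ σ := by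
  by_contra hwσ
  have hne : σ'' ≠ σ := by rintro rfl; exact hwσ hw
  obtain ⟨u, h0, hpos, hneg⟩ := hSep σ'' hσ'' σ hσ hne
  have h1 : 0 < u ⬝ᵥ ((k : ℤ) • w) := by
    rw [dotProduct_smul]; exact smul_pos (by exact_mod_cast hk) (hpos w hw hwσ)
  have h2 : u ⬝ᵥ ((k : ℤ) • w) ≤ 0 := by
    rw [← hx, dotProduct_sum]
    refine Finset.sum_nonpos (fun ρ hρ => ?_)
    rw [dotProduct_smul]
    by_cases hρ'' : ρ ∈ σ''
    · rw [h0 ρ hρ'' hρ, smul_zero]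
    · exact smul_nonpos_of_nonneg_of_nonpos (by positivity) (hneg ρ hρ hρ'').le
  exact absurd h2 (not_le.2 h1)

/-- **FAN EXCLUSION, three-term form.** In a separated position, if a positive multiple of a ray `w` of a cone `σ''` is a non-negative combination
of three rays of a cone `σ`, then `w ∈ σ`. [OURS · L1 W4.5b · brick 2a] -/
theorem mem_of_smul_eq_three {F : Finset (Finset (Ray n))} (hSep : Separated F) {σ σ'' : Finset (Ray n)} (hσ : σ ∈ F) (hσ'' : σ'' ∈ F)
    {w : Ray n} (hw : w ∈ σ'') {k : ℤ} (hk : 0 < k) {p q r : Ray n} (hp : p ∈ σ) (hq : q ∈ σ) (hr : r ∈ σ)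
    {cp cq cr : ℤ} (hcp : 0 ≤ cp) (hcq : 0 ≤ cq) (hcr : 0 ≤ cr) (hx : k • w = cp • p + cq • q + cr • r) : w ∈ σ := by
  by_contra hwσ
  have hne : σ'' ≠ σ := by rintro rfl; exact hwσ hw
  obtain ⟨u, h0, hpos, hneg⟩ := hSep σ'' hσ'' σ hσ hne
  have hle : ∀ ρ ∈ σ, u ⬝ᵥ ρ ≤ 0 := fun ρ hρ => by
    by_cases hρ'' : ρ ∈ σ''
    · exact (h0 ρ hρ'' hρ).le
    · exact (hneg ρ hρ hρ'').le
  have h1 : 0 < u ⬝ᵥ (k • w) := by rw [dotProduct_smul]; exact smul_pos hk (hpos w hw hwσ)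
  have h2 : u ⬝ᵥ (k • w) ≤ 0 := by
    rw [hx, dotProduct_add, dotProduct_add, dotProduct_smul, dotProduct_smul, dotProduct_smul]
    have := hle p hp; have := hle q hq; have := hle r hr
    simp only [smul_eq_mul]
    nlinarith
  exact absurd h2 (not_le.2 h1)

/-- Repackaging a combination `a • u + Σ_{ρ ∈ s} d ρ • ρ` as a representation over `insert u s` (merging coefficients if `u ∈ s`), with the
coefficient sum computed. [OURS · bookkeeping] -/
theorem rep_insert (a : ℕ) (d : Ray n → ℕ) (s : Finset (Ray n)) (u x : Ray n)
    (h : (a : ℤ) • u + ∑ ρ ∈ s, (d ρ : ℤ) • ρ = x) :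
    ∃ c' : Ray n → ℕ, Rep (insert u s) c' x ∧ ∑ ρ ∈ insert u s, c' ρ = a + ∑ ρ ∈ s, d ρ := by
  classical
  refine ⟨fun ρ => (if ρ ∈ s then d ρ else 0) + (if ρ = u then a else 0), ?_, ?_⟩
  · unfold Rep
    by_cases hu : u ∈ s
    · rw [Finset.insert_eq_of_mem hu, ← h]
      have : ∑ ρ ∈ s, (((if ρ ∈ s then d ρ else 0) + (if ρ = u then a else 0) : ℕ) : ℤ) • ρ =
          ∑ ρ ∈ s, ((d ρ : ℤ) • ρ + (if ρ = u then (a : ℤ) • u else 0)) :=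
        Finset.sum_congr rfl (fun ρ hρ => by
          rw [if_pos hρ]; split_ifs with h'
          · subst h'; push_cast; rw [add_smul]
          · push_cast; simp)
      rw [this, Finset.sum_add_distrib, Finset.sum_ite_eq' s u (fun _ => (a : ℤ) • u), if_pos hu, add_comm]
    · rw [Finset.sum_insert hu, ← h]
      simp only [if_neg hu, if_true, Nat.zero_add]
      congr 1
      exact Finset.sum_congr rfl (fun ρ hρ => by
        have hρu : ρ ≠ u := by rintro rfl; exact hu hρ
        rw [if_pos hρ, if_neg hρu]; simp)
  · by_cases hu : u ∈ s
    · rw [Finset.insert_eq_of_mem hu]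
      have : ∑ ρ ∈ s, ((if ρ ∈ s then d ρ else 0) + (if ρ = u then a else 0)) =
          ∑ ρ ∈ s, (d ρ + (if ρ = u then a else 0)) :=
        Finset.sum_congr rfl (fun ρ hρ => by rw [if_pos hρ])
      rw [this, Finset.sum_add_distrib, Finset.sum_ite_eq' s u (fun _ => a), if_pos hu, add_comm]
    · rw [Finset.sum_insert hu]
      simp only [if_neg hu, if_true, Nat.zero_add]
      congr 1
      exact Finset.sum_congr rfl (fun ρ hρ => by
        have hρu : ρ ≠ u := by rintro rfl; exact hu hρ
        rw [if_pos hρ, if_neg hρu, Nat.add_zero])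

/-- **Coefficient bookkeeping under a star.** If `x = Σ_{ρ ∈ σ} c ρ • ρ`, `τ ⊆ σ` and `t₀ ∈ τ` carries the least coefficient on `τ`, then `x` is an
`ℕ`-combination of the rays of the child `insert (Σ τ) (σ.erase t₀)`, with coefficient sum SMALLER by `(|τ| − 1) · c t₀`. [OURS · L1 W4.5b · brick 2a] -/
theorem rep_star {σ τ : Finset (Ray n)} {c : Ray n → ℕ} {x : Ray n} (hx : Rep σ c x) (hτσ : τ ⊆ σ) {t₀ : Ray n} (ht₀ : t₀ ∈ τ)
    (hmin : ∀ ρ ∈ τ, c t₀ ≤ c ρ) :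
    ∃ c' : Ray n → ℕ, Rep (insert (∑ ρ ∈ τ, ρ) (σ.erase t₀)) c' x ∧
      (∑ ρ ∈ insert (∑ ρ ∈ τ, ρ) (σ.erase t₀), c' ρ) + (τ.card - 1) * c t₀ = ∑ ρ ∈ σ, c ρ := by
  classical
  have ht₀σ : t₀ ∈ σ := hτσ ht₀
  -- the new coefficients on `σ.erase t₀`
  let d : Ray n → ℕ := fun ρ => if ρ ∈ τ then c ρ - c t₀ else c ρ
  have hd : ∀ ρ ∈ σ.erase t₀, ((d ρ : ℕ) : ℤ) • ρ = (c ρ : ℤ) • ρ - (if ρ ∈ τ then (c t₀ : ℤ) • ρ else 0) := by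
    intro ρ _
    simp only [d]
    split_ifs with h
    · rw [Nat.cast_sub (hmin ρ h), sub_smul]
    · rw [sub_zero]
  have hsum_d : ∑ ρ ∈ σ.erase t₀, ((d ρ : ℕ) : ℤ) • ρ =
      ∑ ρ ∈ σ.erase t₀, (c ρ : ℤ) • ρ - ∑ ρ ∈ τ.erase t₀, (c t₀ : ℤ) • ρ := by
    rw [Finset.sum_congr rfl hd, Finset.sum_sub_distrib, ← Finset.sum_filter]
    congr 1
    apply Finset.sum_congr _ (fun _ _ => rfl)
    ext ρ; simp only [Finset.mem_filter, Finset.mem_erase]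
    constructor
    · rintro ⟨⟨h1, _⟩, h3⟩; exact ⟨h1, h3⟩
    · rintro ⟨h1, h2⟩; exact ⟨⟨h1, hτσ h2⟩, h2⟩
  have hxu : (c t₀ : ℤ) • (∑ ρ ∈ τ, ρ) + ∑ ρ ∈ σ.erase t₀, ((d ρ : ℕ) : ℤ) • ρ = x := by
    rw [hsum_d, ← Finset.add_sum_erase τ (fun ρ => ρ) ht₀, smul_add, Finset.smul_sum, ← hx,
      ← Finset.add_sum_erase σ _ ht₀σ]
    abel
  obtain ⟨c', hrep, hsum⟩ := rep_insert (c t₀) d (σ.erase t₀) (∑ ρ ∈ τ, ρ) x hxu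
  refine ⟨c', hrep, ?_⟩
  rw [hsum]
  -- the sum of the new coefficients
  have hds : ∑ ρ ∈ σ.erase t₀, d ρ + (τ.card - 1) * c t₀ = ∑ ρ ∈ σ.erase t₀, c ρ := by
    have h1 : ∑ ρ ∈ σ.erase t₀, d ρ + ∑ ρ ∈ σ.erase t₀, (if ρ ∈ τ then c t₀ else 0) = ∑ ρ ∈ σ.erase t₀, c ρ := by
      rw [← Finset.sum_add_distrib]
      refine Finset.sum_congr rfl (fun ρ _ => ?_)
      by_cases h : ρ ∈ τ
      · simp only [d, if_pos h]; exact Nat.sub_add_cancel (hmin ρ h)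
      · simp only [d, if_neg h, Nat.add_zero]
    have h2 : ∑ ρ ∈ σ.erase t₀, (if ρ ∈ τ then c t₀ else 0) = (τ.card - 1) * c t₀ := by
      rw [← Finset.sum_filter]
      have : (σ.erase t₀).filter (fun ρ => ρ ∈ τ) = τ.erase t₀ := by
        ext ρ; simp only [Finset.mem_filter, Finset.mem_erase]
        constructor
        · rintro ⟨⟨h1, _⟩, h3⟩; exact ⟨h1, h3⟩
        · rintro ⟨h1, h2⟩; exact ⟨⟨h1, hτσ h2⟩, h2⟩
      rw [this, Finset.sum_const, smul_eq_mul, Finset.card_erase_of_mem ht₀]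
    rw [← h1, h2]
  have := Finset.add_sum_erase σ c ht₀σ
  omega

/-! ### Coverage -/

/-- `Covers F`: every lattice point of the closed orthant is an `ℕ`-combination of the rays of some cone of `F`. [OURS · bookkeeping] -/
def Covers (F : Finset (Finset (Ray n))) : Prop :=
  ∀ x : Ray n, (∀ i, 0 ≤ x i) → ∃ σ ∈ F, ∃ c : Ray n → ℕ, Rep σ c x

/-- The orthant cone covers the closed orthant: `x = Σ xᵢ • eᵢ`. -/
theorem covers_orthant : Covers (orthantFan n) := by
  classical
  intro x hx
  refine ⟨Finset.univ.image (e n), by simp [orthantFan], fun ρ => ∑ i, (if ρ = e n i then (x i).toNat else 0), ?_⟩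
  unfold Rep
  have hinj : Function.Injective (e n) := fun i j h => by
    by_contra hij
    have := congr_fun h i
    simp only [e, Pi.single_apply, if_true, if_neg hij] at this
    exact one_ne_zero this
  rw [Finset.sum_image (fun i _ j _ h => hinj h)]
  have : ∀ i : Fin n, ((∑ j, (if e n i = e n j then (x j).toNat else 0) : ℕ) : ℤ) • e n i = x i • e n i := by
    intro i
    rw [Finset.sum_eq_single i (fun j _ hji => if_neg (fun h => hji (hinj h).symm)) (fun h => absurd (Finset.mem_univ i) h),
      if_pos rfl, Int.toNat_of_nonneg (hx i)]
  rw [Finset.sum_congr rfl (fun i _ => this i)]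
  ext l
  simp only [Finset.sum_apply, Pi.smul_apply, e, Pi.single_apply, smul_eq_mul, mul_ite, mul_one, mul_zero,
    Finset.sum_ite_eq, Finset.mem_univ, if_true]

/-- Coverage survives a star at a face of one of the cones. -/
theorem covers_star {F : Finset (Finset (Ray n))} (hF : Covers F) {τ : Finset (Ray n)} (hτ : τ.Nonempty) :
    Covers (star F τ) := by
  classical
  intro x hx
  obtain ⟨σ, hσ, c, hc⟩ := hF x hx
  by_cases hτσ : τ ⊆ σ
  · obtain ⟨t₀, ht₀, hmin⟩ := Finset.exists_min_image τ c hτ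
    obtain ⟨c', hrep, -⟩ := rep_star hc hτσ ht₀ hmin
    refine ⟨_, ?_, c', hrep⟩
    rw [ND.mem_star_iff]
    exact Or.inr ⟨σ, hσ, hτσ, t₀, ht₀, rfl⟩
  · exact ⟨σ, (ND.mem_star_iff F τ σ).2 (Or.inl ⟨hσ, hτσ⟩), c, hc⟩

/-- **Every position of the local game covers the closed orthant.** [OURS · L1 W4.5b · row iso-w4, brick 2a] -/
theorem covers_of_reach (V : Finset (Fin n → ℕ)) {F₀ F : Finset (Finset (Ray n))} (h : Reach V F₀ F) (h₀ : Covers F₀) : Covers F := by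
  induction h with
  | refl => exact h₀
  | step F₂ τ σ _ _ _ hne _ ih => exact covers_star ih hne

/-- **Every position reachable from `orthantFan n` covers the closed orthant.** [OURS · L1 W4.5b · row iso-w4, brick 2a] -/
theorem covers_of_reach_orthant (V : Finset (Fin n → ℕ)) {F : Finset (Finset (Ray n))} (h : Reach V (orthantFan n) F) : Covers F :=
  covers_of_reach V h covers_orthant

/-! ### The takeover lemma (first competitor along a segment; explicit algebra, no limits) -/

/-- `pair` is additive in the ray. -/
theorem pair_add (x y : Ray n) (m : Fin n → ℕ) : pair (x + y) m = pair x m + pair y m := by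
  simp only [pair, Pi.add_apply, add_mul, Finset.sum_add_distrib]

/-- `pair` is homogeneous in the ray. -/
theorem pair_smul (k : ℤ) (x : Ray n) (m : Fin n → ℕ) : pair (k • x) m = k * pair x m := by
  simp only [pair, Pi.smul_apply, smul_eq_mul, mul_assoc, Finset.mul_sum]

/-- **TAKEOVER LEMMA.**  Along the segment from `a` to `b`: if `m` minimises `⟨a, ·⟩` over `E` but not `⟨b, ·⟩`, then there are a competitor
`m₁ ∈ E` with `⟨b, m₁⟩ < ⟨b, m⟩` and an explicit lattice point `y = B • a + A • b` (`B > 0`, `A ≥ 0`, namely `A = ⟨a, m₁⟩ − ⟨a, m⟩`,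
`B = ⟨b, m⟩ − ⟨b, m₁⟩`, `m₁` minimising `A/B` among the competitors) at which BOTH `m` and `m₁` minimise `⟨y, ·⟩` over `E` — the first point
of the segment where `m` is caught up.  [OURS · L1 W4.5b · row iso-w4, brick 2a; used twice by PHASE 2 and twice by the conclusion] -/
theorem takeover (E : Finset (Fin n → ℕ)) (a b : Ray n) {m : Fin n → ℕ} (hma : ∀ m' ∈ E, pair a m ≤ pair a m')
    (hmb : ∃ m' ∈ E, pair b m' < pair b m) :
    ∃ m₁ ∈ E, ∃ A B : ℤ, 0 ≤ A ∧ 0 < B ∧ pair a m₁ = pair a m + A ∧ pair b m₁ + B = pair b m ∧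
      (∀ m' ∈ E, pair (B • a + A • b) m ≤ pair (B • a + A • b) m') ∧
      pair (B • a + A • b) m₁ = pair (B • a + A • b) m := by
  classical
  -- the competitors and the one with the least ratio `A/B`
  set C := E.filter (fun m' => pair b m' < pair b m) with hC
  have hCne : C.Nonempty := by
    obtain ⟨m', hm', hlt⟩ := hmb
    exact ⟨m', Finset.mem_filter.2 ⟨hm', hlt⟩⟩
  obtain ⟨m₁, hm₁C, hmin⟩ := C.exists_min_image
    (fun m' => ((pair a m' - pair a m : ℤ) : ℚ) / ((pair b m - pair b m' : ℤ) : ℚ)) hCne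
  obtain ⟨hm₁E, hm₁b⟩ := Finset.mem_filter.1 hm₁C
  refine ⟨m₁, hm₁E, pair a m₁ - pair a m, pair b m - pair b m₁, by linarith [hma m₁ hm₁E], by linarith, by ring, by ring,
    fun m' hm' => ?_, ?_⟩
  · -- minimality of `m` at `y`
    rw [pair_add, pair_add, pair_smul, pair_smul, pair_smul, pair_smul]
    have hA' : 0 ≤ pair a m' - pair a m := by linarith [hma m' hm']
    by_cases hc : pair b m' < pair b m
    · -- a competitor: cross-multiplied ratio comparison
      have hB' : (0 : ℚ) < ((pair b m - pair b m' : ℤ) : ℚ) := by exact_mod_cast (show (0:ℤ) < pair b m - pair b m' by linarith)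
      have hB₁ : (0 : ℚ) < ((pair b m - pair b m₁ : ℤ) : ℚ) := by exact_mod_cast (show (0:ℤ) < pair b m - pair b m₁ by linarith)
      have h := hmin m' (Finset.mem_filter.2 ⟨hm', hc⟩)
      rw [div_le_div_iff₀ hB₁ hB'] at h
      have h' : (pair a m₁ - pair a m) * (pair b m - pair b m') ≤ (pair a m' - pair a m) * (pair b m - pair b m₁) := by
        exact_mod_cast h
      nlinarith
    · rw [not_lt] at hc
      nlinarith [hma m₁ hm₁E]
  · rw [pair_add, pair_add, pair_smul, pair_smul, pair_smul, pair_smul]; ring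

end FanGame

end Summit.ResolutionOfSingularities.ResolutionOfSingularities.Cruxes.EquisingularLiftNat.Sections
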